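import Mathlib
import Summits.ResolutionOfSingularities.ResolutionOfSingularities.Theorems.WildQuotientsWildQuotientResolutionJordanFiveMu2CoverDefs

/-!
# R-T rung, `J₅`, `μ₂`-vertex: the cover equation `Φ` is irreducible (so `k[s, Y, pass] ⧸ (Φ)` is a domain)

(crux stmt-ResolutionOfSingularities-15640 `WildQuotients.WildQuotientResolution`, line `Sketch`,
sector `|G| = p`; RUNG V5 of `L/w45c/CHAIN.md` v8.1, brick B7/`HP₂` step (α) part 2c
(res-L1-w45c-plan-1 RULING 2026-08-27T11:12Z; the `IsDomain` input of Király–Lütkebohmert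
`TameTransfer.isRegularRing_fixedPoints_zpowers`, p460154, for the twisted-root cover
`U₂ = (k[s,Y,pass] ⧸ (Φ))[1/î]`). [OURS · L1 W4.5c] — NOT a statement of any manuscript; replaces
the role of no printed item. Prover res-type-036. Def-free.)

`Φ = coverPhi s Y₀ Y₁ Y₂ Y₃ Y₄` (`…Mu2CoverDefs`) is LINEAR in `Y₄`:
`Φ = L·Y₄ + M`, `L = (4 + 12Y₂ + 6sY₁)·Y₀ − 6Y₁²`, `M = Φ|_{Y₄ = 0}` (`coverPhi_eq_lin_mul_add`).
Over a field with `2 ≠ 0`, `3 ≠ 0` (characteristic `p ≥ 5`):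
* `lin_irreducible` — `L` is irreducible in any polynomial ring (LINEAR in `Y₀` with coefficients
  `4 + 12Y₂ + 6sY₁` and `−6Y₁²` relatively prime: a common divisor divides `Y₁²`, hence is a unit or
  divisible by the prime `Y₁`, and `Y₁ ∤ 4 + 12Y₂ + 6sY₁` — evaluate at `0`);
* `not_lin_dvd_coverPhi_zero` — `L ∤ M` (at `Y₀ = Y₁ = 0`, `Y₂ = 2`: `L ↦ 0`, `M ↦ 2·4·(1 − 2) = −8 ≠ 0`);
* `coverPhi_irreducible` — hence `Φ` is irreducible in `k[s, Y₀, …, Y₄, pass]`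
  (`Polynomial.irreducible_C_mul_X_add_C` after singling out `Y₄`), and
  `coverPhi_prime`, `isDomain_quotient_coverPhi`: `(Φ)` is prime and `k[s,Y,pass] ⧸ (Φ)` is a domain.
Ambient ring: `MvPolynomial (Option (Fin n)) k`, `s = X none`, `Yᵢ = X (some ·)` on the slots
`a, b, c, d, e` (as in `…Mu2CoverAction`). Tool: `splitAt_X_*` = `renameEquiv` along
`Equiv.optionSubtypeNe` followed by `optionEquivLeft` (singles out one variable as `Polynomial.X`,
pattern of `ToricExit.splitEquiv_*`, p488136).
-/

-- single-problem summit: the doubled namespace component `ResolutionOfSingularities` is forced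
set_option linter.dupNamespace false

noncomputable section

open MvPolynomial

namespace Summit.ResolutionOfSingularities.ResolutionOfSingularities.Theorems.WildQuotientResolution.JordanFive

section Split

variable (k : Type) [Field k] {ι : Type} [DecidableEq ι] (i : ι)

/-- Singling out the variable `i`: `X i ↦ Polynomial.X` under `k[ι] ≅ k[ι ∖ i][X]`. [folklore] -/
theorem splitAt_X_self :
    ((renameEquiv k (Equiv.optionSubtypeNe i).symm).trans
        (optionEquivLeft k {j : ι // j ≠ i})) (X i) = Polynomial.X := by
  rw [AlgEquiv.trans_apply, renameEquiv_apply, rename_X, Equiv.optionSubtypeNe_symm_self,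
    optionEquivLeft_X_none]

/-- Singling out the variable `i`: `X j ↦ C (X ⟨j, _⟩)` for `j ≠ i`. [folklore] -/
theorem splitAt_X_of_ne (j : ι) (hj : j ≠ i) :
    ((renameEquiv k (Equiv.optionSubtypeNe i).symm).trans
        (optionEquivLeft k {j : ι // j ≠ i})) (X j) = Polynomial.C (X ⟨j, hj⟩) := by
  rw [AlgEquiv.trans_apply, renameEquiv_apply, rename_X, Equiv.optionSubtypeNe_symm_of_ne hj,
    optionEquivLeft_X_some]

end Split

section Lin

variable (k : Type) [Field k] {ι : Type} [DecidableEq ι]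

omit [DecidableEq ι] in
/-- `X i₁ ∤ 4 + 12·X i₂ + 6·X iₛ·X i₁` (evaluate at `0`: `4 ≠ 0`). [folklore] -/
theorem not_X_dvd_linCoeff (h2 : (2 : k) ≠ 0) (i₁ i₂ iₛ : ι) :
    ¬ ((X i₁ : MvPolynomial ι k) ∣ 4 + 12 * X i₂ + 6 * X iₛ * X i₁) := by
  intro h
  have h' := map_dvd (MvPolynomial.eval (fun _ : ι => (0 : k))) h
  simp only [map_add, map_mul, eval_X, map_ofNat, mul_zero, add_zero, zero_dvd_iff] at h'
  exact (show (4 : k) ≠ 0 by rw [show (4 : k) = 2 * 2 by norm_num]; exact mul_ne_zero h2 h2) h'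

omit [DecidableEq ι] in
/-- `4 + 12·X i₂ + 6·X iₛ·X i₁ ≠ 0` (its value at `0` is `4`). [folklore] -/
theorem linCoeff_ne_zero (h2 : (2 : k) ≠ 0) (i₁ i₂ iₛ : ι) :
    (4 + 12 * X i₂ + 6 * X iₛ * X i₁ : MvPolynomial ι k) ≠ 0 := by
  intro h
  have h' := congrArg (MvPolynomial.eval (fun _ : ι => (0 : k))) h
  simp only [map_add, map_mul, eval_X, map_ofNat, mul_zero, add_zero, map_zero] at h'
  exact (show (4 : k) ≠ 0 by rw [show (4 : k) = 2 * 2 by norm_num]; exact mul_ne_zero h2 h2) h'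

/-- **`L = (4 + 12Y₂ + 6sY₁)·Y₀ − 6Y₁²` is irreducible** in any polynomial ring over a field with
`2, 3 ≠ 0` (`Y₀, Y₁, Y₂, s` distinct variables): it is linear in `Y₀` with relatively prime
coefficients. [OURS · L1 W4.5c] -/
theorem lin_irreducible (h2 : (2 : k) ≠ 0) (h3 : (3 : k) ≠ 0) (i₀ i₁ i₂ iₛ : ι) (h01 : i₀ ≠ i₁)
    (h02 : i₀ ≠ i₂) (h0s : i₀ ≠ iₛ) :
    Irreducible ((4 + 12 * X i₂ + 6 * X iₛ * X i₁) * X i₀ - 6 * X i₁ ^ 2 : MvPolynomial ι k) := by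
  set Ψ := (renameEquiv k (Equiv.optionSubtypeNe i₀).symm).trans
    (optionEquivLeft k {j : ι // j ≠ i₀}) with hΨ
  have hΨ0 : Ψ (X i₀) = Polynomial.X := splitAt_X_self k i₀
  have h10 : i₁ ≠ i₀ := fun h => h01 h.symm
  have h20 : i₂ ≠ i₀ := fun h => h02 h.symm
  have hs0 : iₛ ≠ i₀ := fun h => h0s h.symm
  have hΨ1 : Ψ (X i₁) = Polynomial.C (X ⟨i₁, h10⟩) := splitAt_X_of_ne k i₀ i₁ h10
  have hΨ2 : Ψ (X i₂) = Polynomial.C (X ⟨i₂, h20⟩) := splitAt_X_of_ne k i₀ i₂ h20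
  have hΨs : Ψ (X iₛ) = Polynomial.C (X ⟨iₛ, hs0⟩) := splitAt_X_of_ne k i₀ iₛ hs0
  set α : MvPolynomial {j : ι // j ≠ i₀} k :=
    4 + 12 * X ⟨i₂, h20⟩ + 6 * X ⟨iₛ, hs0⟩ * X ⟨i₁, h10⟩ with hα
  have himage : Ψ ((4 + 12 * X i₂ + 6 * X iₛ * X i₁) * X i₀ - 6 * X i₁ ^ 2) =
      Polynomial.C α * Polynomial.X + Polynomial.C (-6 * X ⟨i₁, h10⟩ ^ 2) := by
    simp only [map_sub, map_add, map_mul, map_pow, map_neg, map_ofNat, hΨ0, hΨ1, hΨ2, hΨs, hα]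
    ring
  rw [← MulEquiv.irreducible_iff Ψ, himage]
  refine Polynomial.irreducible_C_mul_X_add_C (linCoeff_ne_zero k h2 _ _ _) ?_
  -- `IsRelPrime α (−6·Y₁²)`: `−6` is a unit, and `Y₁ ∤ α`
  have h6k : (6 : k) ≠ 0 := by
    rw [show (6 : k) = 2 * 3 by norm_num]; exact mul_ne_zero h2 h3
  have h6 : IsUnit (-6 : MvPolynomial {j : ι // j ≠ i₀} k) := by
    have hC : IsUnit (C (-6 : k) : MvPolynomial {j : ι // j ≠ i₀} k) :=
      (isUnit_iff_ne_zero.mpr (neg_ne_zero.mpr h6k)).map C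
    rwa [map_neg, map_ofNat] at hC
  refine (isRelPrime_mul_unit_left_right h6).mpr (IsRelPrime.pow_right ?_)
  have hY₁ : Irreducible (X ⟨i₁, h10⟩ : MvPolynomial {j : ι // j ≠ i₀} k) :=
    (MvPolynomial.X_prime (R := k) (i := (⟨i₁, h10⟩ : {j : ι // j ≠ i₀}))).irreducible
  rw [isRelPrime_comm, hY₁.isRelPrime_iff_not_dvd]
  exact not_X_dvd_linCoeff k h2 _ _ _

end Lin

section Phi

variable (k : Type) [Field k] (n : ℕ) (a b c d e : Fin n)
  (hab : a ≠ b) (hac : a ≠ c) (hae : a ≠ e) (hbc : b ≠ c) (hbe : b ≠ e) (hce : c ≠ e)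
  (hde : d ≠ e) (h2 : (2 : k) ≠ 0) (h3 : (3 : k) ≠ 0)

include hac hbc h2 in
/-- **`L ∤ Φ|_{Y₄ = 0}`**: evaluate at `Y₀ = Y₁ = 0`, `Y₂ = 2` (`L ↦ 0`, `Φ|_{Y₄=0} ↦ −8 ≠ 0`);
stated in the polynomial ring on the slots `≠ some e` (where `Φ` becomes linear in `Y₄`).
[OURS · L1 W4.5c] -/
theorem not_lin_dvd_coverPhi_zero (hne : Option.some a ≠ some e) (hbe' : Option.some b ≠ some e)
    (hce' : Option.some c ≠ some e) (hde' : Option.some d ≠ some e)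
    (hn : (none : Option (Fin n)) ≠ some e) :
    ¬ (((4 + 12 * X ⟨some c, hce'⟩ + 6 * X ⟨none, hn⟩ * X ⟨some b, hbe'⟩) * X ⟨some a, hne⟩ -
        6 * X ⟨some b, hbe'⟩ ^ 2 : MvPolynomial {o : Option (Fin n) // o ≠ some e} k) ∣
      coverPhi (X ⟨none, hn⟩) (X ⟨some a, hne⟩) (X ⟨some b, hbe'⟩) (X ⟨some c, hce'⟩)
        (X ⟨some d, hde'⟩) 0) := by
  classical
  intro h
  let x₀ : {o : Option (Fin n) // o ≠ some e} → k := fun t => if t.1 = some c then 2 else 0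
  have hxa : x₀ ⟨some a, hne⟩ = 0 := if_neg (fun h => hac (Option.some_inj.mp h))
  have hxb : x₀ ⟨some b, hbe'⟩ = 0 := if_neg (fun h => hbc (Option.some_inj.mp h))
  have hxc : x₀ ⟨some c, hce'⟩ = 2 := if_pos rfl
  have hxn : x₀ ⟨none, hn⟩ = 0 := if_neg (Option.some_ne_none c).symm
  have h' := map_dvd (MvPolynomial.eval x₀) h
  rw [map_coverPhi _ _ _ _ _ _ (MvPolynomial.eval x₀)] at h'
  simp only [map_sub, map_add, map_mul, map_pow, eval_X, map_ofNat, map_zero, hxa, hxb, hxc,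
    hxn] at h'
  rw [coverPhi_zero_zero] at h'
  norm_num at h'
  -- h' : (8 : k) = 0 (or an equivalent normal form); contradiction with `2 ≠ 0`
  have h8 : (2 : k) * 2 * 2 = 0 := by linear_combination h'
  exact mul_ne_zero (mul_ne_zero h2 h2) h2 h8

include hab hac hae hbc hbe hce hde h2 h3 in
/-- **`Φ = coverPhi s Y₀ Y₁ Y₂ Y₃ Y₄` is irreducible** in `k[s, Y₀, …, Y₄, passengers]`
(`2, 3 ≠ 0`). [OURS · L1 W4.5c] -/
theorem coverPhi_irreducible :
    Irreducible (coverPhi (X none) (X (some a)) (X (some b)) (X (some c)) (X (some d))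
      (X (some e)) : MvPolynomial (Option (Fin n)) k) := by
  classical
  have hne : Option.some a ≠ some e := fun h => hae (Option.some_inj.mp h)
  have hbe' : Option.some b ≠ some e := fun h => hbe (Option.some_inj.mp h)
  have hce' : Option.some c ≠ some e := fun h => hce (Option.some_inj.mp h)
  have hde' : Option.some d ≠ some e := fun h => hde (Option.some_inj.mp h)
  have hn : (none : Option (Fin n)) ≠ some e := (Option.some_ne_none e).symm
  set Ψ := (renameEquiv k (Equiv.optionSubtypeNe (some e)).symm).trans
    (optionEquivLeft k {o : Option (Fin n) // o ≠ some e}) with hΨ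
  have hΨe : Ψ (X (some e)) = Polynomial.X := splitAt_X_self k (some e)
  have hΨn : Ψ (X none) = Polynomial.C (X ⟨none, hn⟩) := splitAt_X_of_ne k (some e) none hn
  have hΨa : Ψ (X (some a)) = Polynomial.C (X ⟨some a, hne⟩) := splitAt_X_of_ne k _ _ hne
  have hΨb : Ψ (X (some b)) = Polynomial.C (X ⟨some b, hbe'⟩) := splitAt_X_of_ne k _ _ hbe'
  have hΨc : Ψ (X (some c)) = Polynomial.C (X ⟨some c, hce'⟩) := splitAt_X_of_ne k _ _ hce'
  have hΨd : Ψ (X (some d)) = Polynomial.C (X ⟨some d, hde'⟩) := splitAt_X_of_ne k _ _ hde'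
  set L' : MvPolynomial {o : Option (Fin n) // o ≠ some e} k :=
    (4 + 12 * X ⟨some c, hce'⟩ + 6 * X ⟨none, hn⟩ * X ⟨some b, hbe'⟩) * X ⟨some a, hne⟩ -
      6 * X ⟨some b, hbe'⟩ ^ 2 with hL'
  set M' : MvPolynomial {o : Option (Fin n) // o ≠ some e} k :=
    coverPhi (X ⟨none, hn⟩) (X ⟨some a, hne⟩) (X ⟨some b, hbe'⟩) (X ⟨some c, hce'⟩)
      (X ⟨some d, hde'⟩) 0 with hM'
  have himage : Ψ (coverPhi (X none) (X (some a)) (X (some b)) (X (some c)) (X (some d))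
      (X (some e))) = Polynomial.C L' * Polynomial.X + Polynomial.C M' := by
    have h := map_coverPhi (X none) (X (some a)) (X (some b)) (X (some c)) (X (some d))
      (X (some e)) (Ψ : MvPolynomial (Option (Fin n)) k →+*
        Polynomial (MvPolynomial {o : Option (Fin n) // o ≠ some e} k))
    simp only [RingHom.coe_coe] at h
    rw [h, hΨn, hΨa, hΨb, hΨc, hΨd, hΨe, coverPhi_eq_lin_mul_add, coverPhi_lin_eq, hM',
      map_coverPhi _ _ _ _ _ _ (Polynomial.C : MvPolynomial {o : Option (Fin n) // o ≠ some e} k →+*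
        Polynomial (MvPolynomial {o : Option (Fin n) // o ≠ some e} k)), map_zero, hL']
    simp only [map_sub, map_add, map_mul, map_pow, map_ofNat]
  rw [← MulEquiv.irreducible_iff Ψ, himage]
  refine Polynomial.irreducible_C_mul_X_add_C ?_ ?_
  · -- `L' ≠ 0`: its value at `Y₀ = 1`, everything else `0`, is `4`
    intro h0
    let x₁ : {o : Option (Fin n) // o ≠ some e} → k := fun t => if t.1 = some a then 1 else 0
    have h' := congrArg (MvPolynomial.eval x₁) h0
    have hxa : x₁ ⟨some a, hne⟩ = 1 := if_pos rfl
    have hxb : x₁ ⟨some b, hbe'⟩ = 0 := if_neg (fun h => hab (Option.some_inj.mp h).symm)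
    have hxc : x₁ ⟨some c, hce'⟩ = 0 := if_neg (fun h => hac (Option.some_inj.mp h).symm)
    have hxn : x₁ ⟨none, hn⟩ = 0 := if_neg (Option.some_ne_none a).symm
    rw [hL'] at h'
    simp only [map_sub, map_add, map_mul, map_pow, eval_X, map_ofNat, map_zero, hxa, hxb, hxc,
      hxn] at h'
    norm_num at h'
    exact (show (4 : k) ≠ 0 by rw [show (4 : k) = 2 * 2 by norm_num]; exact mul_ne_zero h2 h2) h'
  · rw [hL', hM']
    exact (lin_irreducible k h2 h3 _ _ _ _
        (fun h => hab (Option.some_inj.mp (congrArg Subtype.val h)))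
        (fun h => hac (Option.some_inj.mp (congrArg Subtype.val h)))
        (fun h => Option.some_ne_none a (congrArg Subtype.val h))).isRelPrime_iff_not_dvd.mpr
      (not_lin_dvd_coverPhi_zero k n a b c d e hac hbc h2 hne hbe' hce' hde' hn)

include hab hac hae hbc hbe hce hde h2 h3 in
/-- **`Φ` is prime** (irreducible in the UFD `k[s, Y, pass]`). [OURS · L1 W4.5c] -/
theorem coverPhi_prime :
    Prime (coverPhi (X none) (X (some a)) (X (some b)) (X (some c)) (X (some d))
      (X (some e)) : MvPolynomial (Option (Fin n)) k) :=
  (coverPhi_irreducible k n a b c d e hab hac hae hbc hbe hce hde h2 h3).prime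

include hab hac hae hbc hbe hce hde h2 h3 in
/-- **`k[s, Y₀,…,Y₄, pass] ⧸ (Φ)` is a domain.** [OURS · L1 W4.5c] -/
theorem isDomain_quotient_coverPhi :
    IsDomain (MvPolynomial (Option (Fin n)) k ⧸ Ideal.span
      {coverPhi (X none) (X (some a)) (X (some b)) (X (some c)) (X (some d))
        (X (some e) : MvPolynomial (Option (Fin n)) k)}) := by
  have hP := coverPhi_prime k n a b c d e hab hac hae hbc hbe hce hde h2 h3
  haveI : (Ideal.span {coverPhi (X none) (X (some a)) (X (some b)) (X (some c)) (X (some d))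
      (X (some e) : MvPolynomial (Option (Fin n)) k)}).IsPrime :=
    (Ideal.span_singleton_prime hP.ne_zero).mpr hP
  exact Ideal.Quotient.isDomain _

end Phi

end Summit.ResolutionOfSingularities.ResolutionOfSingularities.Theorems.WildQuotientResolution.JordanFive

end
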